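import Mathlib
import Summits.ResolutionOfSingularities.ResolutionOfSingularities.Theses.PAlteration

/-!
# Sketch — crux-ideate stmt-ResolutionOfSingularities-0557 (`PAlteration.PicoverLocalModel`), ideator 1, round 1

First-lemma signatures for the idea cards (nothing is proved here; every `def` is a `Prop`).

* Card `hyperbolic-splitting-suspension` (FILED, `Ideas/hyperbolic-splitting-suspension.md`):
  `MorseSplittingModFrobenius`, `SncSystem`, `SuspensionRing`, `ToroidalSuspension`,
  `SuspensionChart`, `LocallyMonomialPullback`, `LogPrincipalizationDim3`, `SuspensionDescent`,
  `SplitRadicandDimFour`, `SplitRadicandOfSuspension`, `SplitLocusResolved`.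
* Line `perfection-sandwich-descent` (CONSIDERED, NOT FILED — reduces to the crux: Posva,
  arXiv:2311.16694, derives dim-3 foliation resolution from Cossart–Piltant + Cossart's normal
  form; see the ideator's NOTES.md): `SandwichStep`, `SandwichTransfer` kept for the record.
-/

set_option linter.dupNamespace false

open Polynomial AlgebraicGeometry CategoryTheory
open Literature.AlgebraicGeometry.Resolution

namespace Summit.ResolutionOfSingularities.ResolutionOfSingularities.Cruxes.PicoverLocalModel.Ideator1

universe u

/-! ## Card A — hyperbolic splitting / suspension -/

/-- **Morse splitting modulo `p`-th powers** (first lemma of card A, formal version).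
In `k⟦X₀,…,X_{m+1}⟧`, `k` a field of characteristic `p`, a series of the form
`a = X₀·X₁ + c` with `c ∈ 𝔪³` can be brought, by a `k`-algebra automorphism `φ` and up to a
`p`-th power `b^p`, to the split form `X₀·X₁ + G(X₂,…,X_{m+1})` with `G` a series in the
LAST `m` variables only. (The classical splitting lemma for a hyperbolic plane holds in every
characteristic because no division by `2` occurs; the `b^p` slack is the torsor's freedom
`A_a ≅ A_{a+b^p}`.) -/
def MorseSplittingModFrobenius : Prop :=
  ∀ (p : ℕ) [Fact p.Prime] (k : Type) [Field k] [CharP k p] (m : ℕ)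
    (a c : MvPowerSeries (Fin (m + 2)) k),
    c ∈ (IsLocalRing.maximalIdeal (MvPowerSeries (Fin (m + 2)) k)) ^ 3 →
    a = MvPowerSeries.X 0 * MvPowerSeries.X 1 + c →
    ∃ (φ : MvPowerSeries (Fin (m + 2)) k ≃ₐ[k] MvPowerSeries (Fin (m + 2)) k)
      (b : MvPowerSeries (Fin (m + 2)) k) (G : MvPowerSeries (Fin m) k),
      MvPowerSeries.constantCoeff G = 0 ∧
      φ a = MvPowerSeries.X 0 * MvPowerSeries.X 1
        + MvPowerSeries.subst (fun i : Fin m => (MvPowerSeries.X (Fin.addNat i 2) :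
            MvPowerSeries (Fin (m + 2)) k)) G
        + b ^ p

/-- A family `e : Fin r → S` is an **snc system** if every partial intersection
`S ⧸ (e_j : j ∈ J)` is again a regular ring (all strata of the divisor `∏ e_i = 0` regular). -/
def SncSystem {S : Type u} [CommRing S] {r : ℕ} (e : Fin r → S) : Prop :=
  ∀ J : Finset (Fin r), IsRegularRing (S ⧸ Ideal.span (e '' (J : Set (Fin r))))

/-- The suspension hypersurface `x·y = H` over a ring `S`: `S[x,y]/(xy - H)`. -/
abbrev SuspensionRing (S : Type u) [CommRing S] (H : S) : Type u :=
  MvPolynomial (Fin 2) S ⧸ Ideal.span {(MvPolynomial.X 0 * MvPolynomial.X 1 -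
    MvPolynomial.C H : MvPolynomial (Fin 2) S)}

/-- **Toroidal end case** (card A, stub-sized): over a regular finitely generated `k`-domain `S`,
for an snc system `e`, exponents `M` and a unit `u`, the binomial hypersurface
`x·y = u·∏ e_i^{M_i}` has a resolution of singularities (it is a toroidal embedding without
self-intersection for the boundary `x·y·∏ e_i = 0`; KKMS subdivision is characteristic-free). -/
def ToroidalSuspension : Prop :=
  ∀ (k : Type) [Field k] (S : Type) [CommRing S] [IsDomain S] [Algebra k S],
    Algebra.FiniteType k S → IsRegularRing S →
    ∀ (r : ℕ) (e : Fin r → S) (M : Fin r → ℕ) (u : Sˣ), SncSystem e →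
      Scheme.HasResolution (Spec (.of (SuspensionRing S ((u : S) * ∏ i, e i ^ M i))))

/-- **Suspension chart identity** (card A, the mechanism's engine, pure commutative algebra):
blowing up the suspension `x·y = H` along the "axis" ideal `(x, y, I)` — where `I ⊆ S` is an
ideal with `H ∈ I²` (the centre lies in the singular locus of the divisor `H = 0`) — has, on the
chart where a generator `g ∈ I` generates the exceptional ideal, again the suspension shape
`x'·y' = H/g²` over the affine blow-up algebra `S[I/g]`. Recorded here in its ring-theoretic
core: if `H = g² · H'` in an overring `S'` of `S` (the chart ring) then the suspension ring of
`H'` over `S'` receives the suspension ring of `H` over `S` compatibly with `x ↦ g x'`,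
`y ↦ g y'`. -/
def SuspensionChart : Prop :=
  ∀ (S S' : Type) [CommRing S] [CommRing S'] [Algebra S S'] (H : S) (g H' : S'),
    algebraMap S S' H = g ^ 2 * H' →
    ∃ f : SuspensionRing S H →ₐ[S] SuspensionRing S' H',
      f (Ideal.Quotient.mk _ (MvPolynomial.X 0)) =
          Ideal.Quotient.mk _ (MvPolynomial.C g * MvPolynomial.X 0) ∧
      f (Ideal.Quotient.mk _ (MvPolynomial.X 1)) =
          Ideal.Quotient.mk _ (MvPolynomial.C g * MvPolynomial.X 1)

/-- **Witt-index-one reduction in dimension four** (card A, the line's load-bearing transfer for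
`dim R = 4`, stated for the local model ring of the crux): if at every point of the singular
locus of `X_a` the radicand class splits off a hyperbolic plane (hypothesis `hsplit`, phrased
through `MorseSplittingModFrobenius`-shaped data in the completed local rings — kept abstract
here as a predicate on `(R, a)`), then `X_a` has a resolution. The honest residual of the line is
the complement of `hsplit` (umbilic points). -/
def SplitLocusResolved
    (HasHyperbolicSplittingEverywhere :
      ∀ (R : Type) [CommRing R], R → Prop) : Prop :=
  ∀ (p : ℕ), p.Prime → ∀ (k : Type) [Field k] [CharP k p] [PerfectField k]
    (R : Type) [CommRing R] [IsDomain R] [Algebra k R],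
    Algebra.FiniteType k R → IsRegularRing R → ringKrullDim R ≤ 4 → ∀ a : R,
    HasHyperbolicSplittingEverywhere R a →
    Scheme.HasResolution (Spec (.of (AdjoinRoot ((X : R[X]) ^ p - C a) ⧸
      nilradical (AdjoinRoot ((X : R[X]) ^ p - C a)))))

/-- **Locally monomial pull-back** of a function `H ∈ S` along `π : W ⟶ Spec S`: at every
point `w` of `W` the germ of `π^* H` is a unit times a monomial in an snc system of the (regular)
local ring `𝒪_{W,w}` — i.e. the total transform of the divisor `H = 0` is a normal crossings
divisor. -/
def LocallyMonomialPullback (S : Type) [CommRing S] (H : S) (W : Scheme.{0})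
    (π : W ⟶ Spec (.of S)) : Prop :=
  ∀ w : W, ∃ (r : ℕ) (e : Fin r → W.presheaf.stalk w) (M : Fin r → ℕ)
      (u : (W.presheaf.stalk w)ˣ),
    (∀ J : Finset (Fin r),
        IsRegularRing ((W.presheaf.stalk w) ⧸ Ideal.span (e '' (J : Set (Fin r))))) ∧
    (W.presheaf.germ ⊤ w trivial) (π.appTop ((Scheme.ΓSpecIso (.of S)).inv H)) =
      (u : W.presheaf.stalk w) * ∏ i, e i ^ M i

/-- **Log-principalization of one hypersurface** `H = 0` in a regular affine `k`-variety `Spec Z`: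
a proper birational `π : W → Spec Z` from a regular `W` with `π^* H` locally monomial. For
`dim Z ≤ 3` this is Cossart–Jannsen–Saito 2020, Thm. 1.4 (canonical embedded resolution with
boundary of the reduced surface `V(H)_red` in the excellent regular threefold `Spec Z`; the
strict transform ends regular and transversal to the exceptional divisor, so the total transform
of `V(H)` is snc). Stated here as the input fact of the line, in the dimension it is needed. -/
def LogPrincipalizationDim3 : Prop :=
  ∀ (k : Type) [Field k] (Z : Type) [CommRing Z] [IsDomain Z] [Algebra k Z],
    Algebra.FiniteType k Z → IsRegularRing Z → ringKrullDim Z ≤ 3 → ∀ H : Z, H ≠ 0 →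
    ∃ (W : Scheme.{0}) (π : W ⟶ Spec (.of Z)),
      IsProper π ∧ IsBirational π ∧ Scheme.IsRegular W ∧ LocallyMonomialPullback Z H W π

/-- **Suspension descent** (card A, the transfer lemma): a log-principalization of `H = 0` on the
regular base `Spec S` yields a resolution of the suspension `x·y = H` — base-change the flat
conic family `{xy = H} → Spec S` along `π` (proper, birational, integral total space since
`xy - π^*H` stays prime), land in the toroidal end case `xy = u·e^M`, finish by
`ToroidalSuspension`. -/
def SuspensionDescent : Prop :=
  ∀ (k : Type) [Field k] (S : Type) [CommRing S] [IsDomain S] [Algebra k S],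
    Algebra.FiniteType k S → IsRegularRing S → ∀ H : S, H ≠ 0 →
    (∃ (W : Scheme.{0}) (π : W ⟶ Spec (.of S)),
      IsProper π ∧ IsBirational π ∧ Scheme.IsRegular W ∧ LocallyMonomialPullback S H W π) →
    Scheme.HasResolution (Spec (.of (SuspensionRing S H)))

/-- **Split radicands in dimension four** (card A, first NEW case of the crux the line delivers):
for `S` a regular finitely generated `k`-domain of dimension `≤ 2`, `a₀ ∈ S`, and the GLOBALLY
split radicand `a = a₀ + u·v` on `R = S[u,v]` (regular of dimension `≤ 4`), the local model
`Spec (R[T]/(T^p - a))_red` has a resolution: it IS the suspension `u·v = T^p - a₀` over the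
regular threefold ring `S[T]`, so `LogPrincipalizationDim3` + `SuspensionDescent` apply. The
torsor `{T^p = a₀ + uv}` is a genuinely four-dimensional `α_p`-torsor (singular exactly over
`Crit(a₀) × {u = v = 0}`), not a product with a surface. -/
def SplitRadicandDimFour : Prop :=
  ∀ (p : ℕ), p.Prime → ∀ (k : Type) [Field k] [CharP k p]
    (S : Type) [CommRing S] [IsDomain S] [Algebra k S],
    Algebra.FiniteType k S → IsRegularRing S → ringKrullDim S ≤ 2 → ∀ a₀ : S,
    Scheme.HasResolution (Spec (.of
      (AdjoinRoot ((X : (MvPolynomial (Fin 2) S)[X]) ^ p -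
          C (MvPolynomial.C a₀ + MvPolynomial.X 0 * MvPolynomial.X 1)) ⧸
        nilradical (AdjoinRoot ((X : (MvPolynomial (Fin 2) S)[X]) ^ p -
          C (MvPolynomial.C a₀ + MvPolynomial.X 0 * MvPolynomial.X 1))))))

/-- Composition shape of the milestone (to be kernel-checked by the crux-plan seat, not here):
the two transfer lemmas give the split-radicand case. -/
def SplitRadicandOfSuspension : Prop :=
  LogPrincipalizationDim3 → SuspensionDescent → SplitRadicandDimFour

/-! ## Card B — perfection sandwich (global `α_p`-quotient descent) -/

/-- **One sandwich step** (card B, first lemma): let `B ⊆ B'` be domains of characteristic `p`,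
finitely generated over a field `k`, with `B'` REGULAR and `B' ^ p ⊆ B` of index `p` at the
level of fraction fields (one `α_p`-quotient step: `B = B' ∩ L` for a subfield `L` with
`[Frac B' : L] = p`). If every rank-one `p`-closed foliation on a regular `k`-variety can be
brought to at worst multiplicative singularities by blow-ups in regular invariant centres
(hypothesis `MultRes`, kept abstract), then `Spec B` has a resolution. -/
def SandwichStep (MultRes : Prop) : Prop :=
  MultRes → ∀ (p : ℕ) [Fact p.Prime] (k : Type) [Field k] [CharP k p] [PerfectField k]
    (B' : Type) [CommRing B'] [IsDomain B'] [Algebra k B'] (B : Subalgebra k B'),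
    Algebra.FiniteType k B' → IsRegularRing B' →
    (∀ x : B', x ^ p ∈ B) → Module.Finite B B' →
    Scheme.HasResolution (Spec (.of B))

/-- **Global sandwich transfer** (card B, composition shape): `n - 1` sandwich steps starting from
the regular top `Spec R^{1/p} ≅ Spec R` reach the normalization of the local model; recorded as
the implication to the crux. -/
def SandwichTransfer (MultRes : Prop) : Prop :=
  SandwichStep MultRes → MultRes →
    Summit.ResolutionOfSingularities.ResolutionOfSingularities.Theses.PAlteration.PicoverLocalModel

end Summit.ResolutionOfSingularities.ResolutionOfSingularities.Cruxes.PicoverLocalModel.Ideator1
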